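import Summits.BirchSwinnertonDyer.BirchSwinnertonDyer.Theses.UniversalToricDescent
import HarnessLib

/-!
# Route `UniversalToricDescent` — act D's package glue `TwinWanFrameAtThreeNonOrdBucketsGlue`
# (item stmt-BirchSwinnertonDyer-26064) HOLDS

Cell `bsd-wall` (W-ALL lane 3, row 2·3@3), seat `bsd-wall-utd-p1` g11, the UTD pen's act-D prover ticket (γ)
(planner pss3x g3, PLAN-D.md D4; route rev 39): the ♭ non-ordinary twin package
`TwinWanFrameAtThreeNonOrdBuckets` (item 25912) IS the conjunction of its two children ♭B
`TwinWanFrameAtThreeMult` (26062) and ♭C₀ `TwinWanFrameAtThreeGoodSSApZero` (26063), definitionally, so the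
generated glue closes by `⟨·, ·⟩` (vet tk5d g7, `Combined_actD_g7.lean` / SketchD.lean). THEOREMS ONLY;
no definition; proves no research binder; BSD is not proved by any of this.
-/

noncomputable section

set_option linter.dupNamespace false
set_option autoImplicit false

namespace Summit.BirchSwinnertonDyer.BirchSwinnertonDyer.Theorems.UniversalToricDescentActDGlue

open Summit.BirchSwinnertonDyer.BirchSwinnertonDyer.Theses.UniversalToricDescent

/-- **The package glue `TwinWanFrameAtThreeNonOrdBucketsGlue` (stmt-BirchSwinnertonDyer-26064) holds**:
♭B → ♭C₀ → (♭B ∧ ♭C₀), the package being the conjunction of the two children by definition. The type is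
literally the route decl. [folklore] -/
theorem twinWanFrameAtThreeNonOrdBucketsGlue_proof :
    Summit.BirchSwinnertonDyer.BirchSwinnertonDyer.Theses.UniversalToricDescent.TwinWanFrameAtThreeNonOrdBucketsGlue :=
  fun hB hC ↦ ⟨hB, hC⟩

end Summit.BirchSwinnertonDyer.BirchSwinnertonDyer.Theorems.UniversalToricDescentActDGlue

end
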